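import Summits.HodgeConjecture.HodgeConjecture.Theorems.AnchorTransportAnchorExistenceK3SquareCMFloorTranscendental
import Literature.AlgebraicGeometry.Motives.HodgeStructureK3TypeProofs

/-!
# Route AnchorTransport — `AnchorExistence` (stmt-HodgeConjecture-1077), line `Sketch`, CM floor:
# Hodge endomorphisms of `Λ_ℚ` versus `End_Hdg(T)`, and the CM span theorem in the marking picture

Marking picture, continued from `…CMFloorTranscendental` (the Hodge structure `hodgeT` of K3 type on
`T = N^⊥ ≤ Λ_ℚ` defined by the period `x`). A rational endomorphism
`φ` of `Λ_ℚ` is HODGE (for the period `x`) when its complexification has `x` as an eigenvector and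
preserves `{x, x̄}^⊥` (the three Hodge types of `H²` of a K3 surface read through a marking). This
file proves: (1) a Hodge `φ` preserves `N` and `T` and restricts to an element of `End_Hdg(T)`
(the tree's `HodgeStructure.endAlg`); conversely an element `u ∈ End_Hdg(T)` extended by the
identity of `N` is a Hodge endomorphism of `Λ_ℚ`, isometric when `u` is
(Huybrechts, *Lectures on K3 Surfaces*, Ch. 3 Lemma 3.1 and §3.2: `H² = NS ⊕ T` rationally, as
Hodge structures); (2) **the CM span theorem in the marking picture**: if some Hodge `φ₀` acts on
`x` by a non-real scalar (complex multiplication), then `End_Hdg(T)` is spanned over `ℚ` by Hodge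
isometries (Zarhin; Huybrechts Thm. 3.3.7 / Rem. 3.3.14, in the tree as
`span_setOf_isometry_eq_top_of_conj_ne` with `Zarhin1983_endAlg_isField_holds`), so EVERY Hodge `φ`
is a sum of rank-one maps `v ↦ (v.aᵢ) bᵢ` with `aᵢ, bᵢ ∈ N` plus a rational combination of Hodge
ISOMETRIES of `Λ_ℚ` (`exists_sum_isometry`) — the linear algebra of the proof of Buskin's
corollary (Huybrechts 2019, Cor. 0.4 (ii)).

## References

* [Huybrechts2016K3] D. Huybrechts, Lectures on K3 Surfaces, CUP 2016, Ch. 3 Lemma 3.3.1, §3.3.3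
  Cor. 3.3.6, Thm. 3.3.7, Rem. 3.3.14.
* [Huybrechts2019] D. Huybrechts, Motives of isogenous K3 surfaces, Comment. Math. Helv. 94 (2019),
  Cor. 0.4 (ii) and Rem. 3.3.
* [Buskin2019] N. Buskin, Every rational Hodge isometry between two K3 surfaces is algebraic,
  J. reine angew. Math. 755 (2019), proof of the Corollary after Thm. 1.1.
-/

noncomputable section

set_option linter.dupNamespace false

open scoped TensorProduct
open Module
open Literature.AlgebraicGeometry.Surfaces Literature.AlgebraicGeometry.Motives
open Literature.AlgebraicGeometry.Motives.HodgeStructure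
open Summit.HodgeConjecture.HodgeConjecture.Theorems.NikulinTwinTransport

namespace Summit.HodgeConjecture.HodgeConjecture.Theorems.AnchorExistenceCMFloor

variable {x : K3Index → ℂ} {N : Submodule ℚ (K3Index → ℚ)}

/-! ### Extending endomorphisms of `T` by the identity of `N` -/

/-- **`û = u ⊕ id_N`**: the extension of an endomorphism `u` of `T = N^⊥` to `Λ_ℚ = N ⊕ T` by the
identity on `N`. [cite: Huybrechts2016K3, Ch. 3 Lemma 3.3.1] -/
def extendT (hdisj : Disjoint N (k3FormRat.orthogonal N)) (u : Module.End ℚ (k3FormRat.orthogonal N)) :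
    Module.End ℚ (K3Index → ℚ) :=
  (k3FormRat.orthogonal N).subtype ∘ₗ u ∘ₗ
      (k3FormRat.orthogonal N).projectionOnto N (isCompl_orthogonal hdisj).symm +
    N.projection _ (isCompl_orthogonal hdisj)

/-- `û v = u (pr_T v) + pr_N v`. [folklore] -/
theorem extendT_apply (hdisj : Disjoint N (k3FormRat.orthogonal N)) (u : Module.End ℚ (k3FormRat.orthogonal N))
    (v : K3Index → ℚ) :
    extendT hdisj u v = (u ((k3FormRat.orthogonal N).projectionOnto N (isCompl_orthogonal hdisj).symm v) :
      K3Index → ℚ) + N.projection _ (isCompl_orthogonal hdisj) v := rfl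

/-- `û t = u t` on `T`. [folklore] -/
theorem extendT_apply_coe (hdisj : Disjoint N (k3FormRat.orthogonal N)) (u : Module.End ℚ (k3FormRat.orthogonal N))
    (t : k3FormRat.orthogonal N) : extendT hdisj u t = u t := by
  rw [extendT_apply, Submodule.projectionOnto_apply_left, Submodule.projection_apply_right, add_zero]

/-- `û n = n` on `N`. [folklore] -/
theorem extendT_apply_of_mem (hdisj : Disjoint N (k3FormRat.orthogonal N)) (u : Module.End ℚ (k3FormRat.orthogonal N))
    {n : K3Index → ℚ} (hn : n ∈ N) : extendT hdisj u n = n := by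
  rw [extendT_apply, Submodule.projectionOnto_apply_of_mem_right _ hn, map_zero, Submodule.coe_zero, zero_add,
    Submodule.projection_apply_of_mem_left _ hn]

/-- `û ∘ pr_N = pr_N`. [folklore] -/
theorem extendT_comp_projection (hdisj : Disjoint N (k3FormRat.orthogonal N))
    (u : Module.End ℚ (k3FormRat.orthogonal N)) :
    extendT hdisj u ∘ₗ N.projection _ (isCompl_orthogonal hdisj) = N.projection _ (isCompl_orthogonal hdisj) :=
  LinearMap.ext fun v => extendT_apply_of_mem hdisj u (Submodule.projection_apply_mem _ v)

/-- **`ι_T ∘ u_ℂ = û_ℂ ∘ ι_T`**: under `ι_T` the abstract base change of `u` is the complexification of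
its extension by the identity. [folklore] -/
theorem iota_baseChange (hdisj : Disjoint N (k3FormRat.orthogonal N)) (u : Module.End ℚ (k3FormRat.orthogonal N))
    (z : ℂ ⊗[ℚ] (k3FormRat.orthogonal N)) :
    iota _ (u.baseChange ℂ z) = cxEnd (extendT hdisj u) (iota _ z) := by
  induction z using TensorProduct.induction_on with
  | zero => rw [map_zero, map_zero, map_zero]
  | tmul c t => rw [LinearMap.baseChange_tmul, iota_tmul, iota_tmul, map_smul, cxEnd_ratCast, extendT_apply_coe]
  | add a b ha hb => rw [map_add, map_add, map_add, map_add, ha, hb]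

/-- **The extension by the identity of an isometry of `T` is an isometry of `Λ_ℚ`** (`N ⊥ T`).
[cite: Huybrechts2016K3, Ch. 3 Lemma 3.3.1] -/
theorem k3FormRat_extendT (hdisj : Disjoint N (k3FormRat.orthogonal N)) (u : Module.End ℚ (k3FormRat.orthogonal N))
    (hu : ∀ a b : k3FormRat.orthogonal N, k3FormRat (u a) (u b) = k3FormRat a b) (v w : K3Index → ℚ) :
    k3FormRat (extendT hdisj u v) (extendT hdisj u w) = k3FormRat v w := by
  have hc := isCompl_orthogonal hdisj
  set P := N.projection _ hc with hP
  set Q' := (k3FormRat.orthogonal N).projectionOnto N hc.symm with hQ'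
  -- `N ⊥ T`
  have orth : ∀ (n : K3Index → ℚ), n ∈ N → ∀ t : k3FormRat.orthogonal N, k3FormRat n t = 0 ∧ k3FormRat (t : K3Index → ℚ) n = 0 :=
    fun n hn t => by
      have h := (LinearMap.BilinForm.mem_orthogonal_iff.1 t.2) n hn
      exact ⟨h, by rw [k3FormRat_isSymm.eq]; exact h⟩
  have hv : v = (Q' v : K3Index → ℚ) + P v := by
    rw [hQ', Submodule.coe_projectionOnto_apply, add_comm]
    exact (Submodule.projection_add_projection_eq_self hc v).symm
  have hw : w = (Q' w : K3Index → ℚ) + P w := by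
    rw [hQ', Submodule.coe_projectionOnto_apply, add_comm]
    exact (Submodule.projection_add_projection_eq_self hc w).symm
  have hPv : P v ∈ N := Submodule.projection_apply_mem hc v
  have hPw : P w ∈ N := Submodule.projection_apply_mem hc w
  rw [extendT_apply, extendT_apply, ← hP, ← hQ']
  conv_rhs => rw [hv, hw]
  simp only [map_add, LinearMap.add_apply, (orth _ hPv _).1, (orth _ hPw _).2, hu, add_zero, zero_add]

/-! ### Hodge endomorphisms of `Λ_ℚ` and `End_Hdg(T)` -/

section Hodge

variable (hN : ∀ v : K3Index → ℚ, v ∈ N ↔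
    k3Form (fun i => (v i : ℂ)) x = 0 ∧ k3Form (fun i => (v i : ℂ)) (star x) = 0)
  (hdisj : Disjoint N (k3FormRat.orthogonal N)) (hxx : k3Form x x = 0) (hxpos : 0 < (k3Form (star x) x).re)

include hN in
/-- **A Hodge endomorphism of `Λ_ℚ` preserves `N`** (`N` = the rational vectors of type `(1,1)`).
[cite: Huybrechts2016K3, Ch. 3 Lemma 3.3.1] -/
theorem map_mem_N (φ : Module.End ℚ (K3Index → ℚ))
    (hφ11 : ∀ z : K3Index → ℂ, k3Form z x = 0 → k3Form z (star x) = 0 →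
      k3Form (cxEnd φ z) x = 0 ∧ k3Form (cxEnd φ z) (star x) = 0)
    {n : K3Index → ℚ} (hn : n ∈ N) : φ n ∈ N := by
  rw [hN] at hn ⊢
  have h := hφ11 _ hn.1 hn.2
  rwa [cxEnd_ratCast] at h

omit hN in
/-- The complexification of a Hodge endomorphism has `x̄` as an eigenvector too. [folklore] -/
theorem cxEnd_star_period {φ : Module.End ℚ (K3Index → ℚ)} (hφx : ∃ c : ℂ, cxEnd φ x = c • x) :
    ∃ c : ℂ, cxEnd φ (star x) = c • star x := by
  obtain ⟨c, hc⟩ := hφx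
  exact ⟨star c, by rw [cxEnd_star, hc, star_smul]⟩

include hN in
/-- **A Hodge endomorphism of `Λ_ℚ` preserves `T = N^⊥`**: the Riesz vector `w` of
`v ↦ (φ v.n)` (`n ∈ N`) is again a rational `(1,1)`-vector, so `(φ t.n) = (t.w) = 0` for `t ∈ T`.
[cite: Huybrechts2016K3, Ch. 3 Lemma 3.3.1 and §3.3.5 Lemma 3.3.12] -/
theorem map_mem_T (φ : Module.End ℚ (K3Index → ℚ)) (hφx : ∃ c : ℂ, cxEnd φ x = c • x)
    {t : K3Index → ℚ} (ht : t ∈ k3FormRat.orthogonal N) : φ t ∈ k3FormRat.orthogonal N := by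
  rw [LinearMap.BilinForm.mem_orthogonal_iff]
  intro n hn
  -- the Riesz vector `w` with `B(φ v, n) = B(v, w)`
  set w := (k3FormRat.toDual k3FormRat_nondegenerate).symm ((k3FormRat n) ∘ₗ φ) with hwdef
  have hw : ∀ v, k3FormRat (φ v) n = k3FormRat v w := fun v => by
    rw [k3FormRat_isSymm.eq (φ v) n, hwdef, k3FormRat_isSymm.eq v, LinearMap.BilinForm.apply_toDual_symm_apply]
    rfl
  have hwC : ∀ z : K3Index → ℂ, k3Form (cxEnd φ z) (fun i => (n i : ℂ)) = k3Form z (fun i => (w i : ℂ)) := by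
    intro z
    have hlin : (k3FormC.flip (fun i => (n i : ℂ))) ∘ₗ cxEnd φ = k3FormC.flip (fun i => (w i : ℂ)) := by
      refine eq_of_forall_ratCast fun v => ?_
      rw [LinearMap.comp_apply, cxEnd_ratCast, LinearMap.BilinForm.flip_apply, LinearMap.BilinForm.flip_apply,
        k3FormC_apply, k3FormC_apply, k3Form_ratCast, k3Form_ratCast, hw v]
    have h := LinearMap.congr_fun hlin z
    simpa only [LinearMap.comp_apply, LinearMap.BilinForm.flip_apply, k3FormC_apply] using h
  -- `w` is a rational `(1,1)`-vector
  have hwN : w ∈ N := by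
    obtain ⟨c', hc'⟩ := cxEnd_star_period hφx
    obtain ⟨c, hc⟩ := hφx
    obtain ⟨hnx, hnx'⟩ := k3Form_period_of_mem hN hn
    rw [hN]
    constructor
    · rw [k3Form_comm, ← hwC x, hc, k3Form_smul_left, hnx, mul_zero]
    · rw [k3Form_comm, ← hwC (star x), hc', k3Form_smul_left, hnx', mul_zero]
  change k3FormRat n (φ t) = 0
  rw [k3FormRat_isSymm.eq n (φ t), hw t, k3FormRat_isSymm.eq t w]
  exact (LinearMap.BilinForm.mem_orthogonal_iff.1 ht) w hwN

omit hN hdisj hxx hxpos in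
/-- `ι_T ∘ (φ|_T)_ℂ = φ_ℂ ∘ ι_T`. [folklore] -/
theorem iota_baseChange_restrict (φ : Module.End ℚ (K3Index → ℚ))
    (hφT : ∀ t ∈ k3FormRat.orthogonal N, φ t ∈ k3FormRat.orthogonal N) (z : ℂ ⊗[ℚ] (k3FormRat.orthogonal N)) :
    iota _ ((φ.restrict hφT).baseChange ℂ z) = cxEnd φ (iota _ z) := by
  induction z using TensorProduct.induction_on with
  | zero => rw [map_zero, map_zero, map_zero]
  | tmul c t => rw [LinearMap.baseChange_tmul, iota_tmul, iota_tmul, map_smul, cxEnd_ratCast, LinearMap.coe_restrict_apply]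
  | add a b ha hb => rw [map_add, map_add, map_add, map_add, ha, hb]

include hN hdisj hxx hxpos in
/-- **The restriction to `T` of a Hodge endomorphism of `Λ_ℚ` is a Hodge endomorphism of `T`**
(`(φ|_T)_ℂ ω ∈ ℂ ω`, and `(φ|_T)_ℂ` preserves `ω^⊥ = ℂx ⊕ (x^⊥ ∩ x̄^⊥)`).
[cite: Huybrechts2016K3, Ch. 3 Lemma 3.3.1 and §3.3.3] -/
theorem restrict_mem_endAlg (φ : Module.End ℚ (K3Index → ℚ))
    (hφT : ∀ t ∈ k3FormRat.orthogonal N, φ t ∈ k3FormRat.orthogonal N) (hφx : ∃ c : ℂ, cxEnd φ x = c • x)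
    (hφ11 : ∀ z : K3Index → ℂ, k3Form z x = 0 → k3Form z (star x) = 0 →
      k3Form (cxEnd φ z) x = 0 ∧ k3Form (cxEnd φ z) (star x) = 0) :
    φ.restrict hφT ∈ (hodgeT hN hdisj hxx hxpos).endAlg := by
  obtain ⟨c, hc⟩ := hφx
  have hω : (φ.restrict hφT).baseChange ℂ (omega x hdisj) = c • omega x hdisj := by
    apply iota_injective
    rw [iota_baseChange_restrict, iota_omega hN hdisj, map_smul, iota_omega hN hdisj, hc]
  intro p
  change (periodF (k3FormRat.restrict (k3FormRat.orthogonal N)) (omega x hdisj) p).map _ ≤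
    periodF (k3FormRat.restrict (k3FormRat.orthogonal N)) (omega x hdisj) p
  by_cases hp0 : p ≤ 0
  · rw [periodF_of_le_zero _ _ hp0]; exact le_top
  by_cases hp1 : p = 1
  · subst hp1
    rw [Submodule.map_le_iff_le_comap]
    intro w hw
    rw [Submodule.mem_comap, mem_periodF_one, restrict_baseChange_apply, iota_omega hN hdisj, iota_baseChange_restrict]
    rw [mem_periodF_one, restrict_baseChange_apply, iota_omega hN hdisj] at hw
    obtain ⟨-, hne⟩ := k3Form_self_star_period hxpos
    set v := iota _ w with hv
    set a : ℂ := k3Form v (star x) / k3Form x (star x) with ha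
    have h1 : k3Form (v - a • x) x = 0 := by
      rw [k3Form_sub_left, k3Form_smul_left, hxx, mul_zero, sub_zero, k3Form_comm]; exact hw
    have h2 : k3Form (v - a • x) (star x) = 0 := by
      rw [k3Form_sub_left, k3Form_smul_left, ha, div_mul_cancel₀ _ hne, sub_self]
    obtain ⟨h3, -⟩ := hφ11 _ h1 h2
    have hsplit : cxEnd φ v = cxEnd φ (v - a • x) + a • cxEnd φ x := by rw [map_sub, map_smul]; abel
    rw [k3Form_comm, hsplit, k3Form_add_left, h3, hc, k3Form_smul_left, k3Form_smul_left, hxx, mul_zero, mul_zero,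
      add_zero]
  by_cases hp2 : p = 2
  · subst hp2
    rw [Submodule.map_le_iff_le_comap]
    intro w hw
    obtain ⟨d, rfl⟩ := (mem_periodF_two _ _).1 hw
    rw [Submodule.mem_comap, map_smul, hω, smul_smul, mem_periodF_two]
    exact ⟨d * c, rfl⟩
  · rw [periodF_of_three_le _ _ (by omega), Submodule.map_bot]

include hN hdisj hxx hxpos in
/-- **An element of `End_Hdg(T)` extended by the identity is a Hodge endomorphism of `Λ_ℚ`, I**:
`x` is an eigenvector of `û_ℂ`. [cite: Huybrechts2016K3, Ch. 3 §3.3.3 Cor. 3.3.6] -/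
theorem cxEnd_extendT_period {u : Module.End ℚ (k3FormRat.orthogonal N)}
    (hu : u ∈ (hodgeT hN hdisj hxx hxpos).endAlg) : ∃ c : ℂ, cxEnd (extendT hdisj u) x = c • x := by
  obtain ⟨c, hc⟩ := exists_smul_eq_of_mem_endAlg_ofPeriod _ _ hu
  refine ⟨c, ?_⟩
  rw [← iota_omega hN hdisj, ← iota_baseChange, hc, map_smul]

include hN hdisj hxx hxpos in
/-- **An element of `End_Hdg(T)` extended by the identity is a Hodge endomorphism of `Λ_ℚ`, II**:
`û_ℂ` preserves `{x, x̄}^⊥` (`= N_ℂ ⊕ T^{1,1}`: it is the identity on `N_ℂ`, and on `T_ℂ ∩ x^⊥` it is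
`u_ℂ`, which preserves `F¹ = ω^⊥` and its conjugate). [cite: Huybrechts2016K3, Ch. 3 Lemma 3.3.1 and §3.3.3] -/
theorem k3Form_cxEnd_extendT {u : Module.End ℚ (k3FormRat.orthogonal N)}
    (hu : u ∈ (hodgeT hN hdisj hxx hxpos).endAlg) {z : K3Index → ℂ} (hzx : k3Form z x = 0)
    (hzx' : k3Form z (star x) = 0) :
    k3Form (cxEnd (extendT hdisj u) z) x = 0 ∧ k3Form (cxEnd (extendT hdisj u) z) (star x) = 0 := by
  have hc := isCompl_orthogonal hdisj
  have hz := cxEnd_projection_add_apply hc z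
  obtain ⟨hPx, hPx'⟩ := k3Form_cxEnd_projection hN hdisj z
  -- `û_ℂ ∘ pr_{N,ℂ} = pr_{N,ℂ}`
  have h1 : cxEnd (extendT hdisj u) (cxEnd (N.projection _ hc) z) = cxEnd (N.projection _ hc) z := by
    rw [← LinearMap.comp_apply, ← cxEnd_comp, extendT_comp_projection]
  -- `pr_{T,ℂ} z = ι_T (λ z)` is orthogonal to `x`, `x̄`
  have hQ : cxEnd ((k3FormRat.orthogonal N).projection N hc.symm) z = iota _ (lam hc z) := (iota_lam hc z).symm
  have hQx : k3Form (cxEnd ((k3FormRat.orthogonal N).projection N hc.symm) z) x = 0 := by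
    have h := congrArg (fun w => k3Form w x) hz
    simp only [k3Form_add_left, hPx, zero_add, hzx] at h
    exact h
  have hQx' : k3Form (cxEnd ((k3FormRat.orthogonal N).projection N hc.symm) z) (star x) = 0 := by
    have h := congrArg (fun w => k3Form w (star x)) hz
    simp only [k3Form_add_left, hPx', zero_add, hzx'] at h
    exact h
  rw [hQ] at hQx hQx'
  -- `λ z ∈ F¹ ∩ conj F¹`, preserved by `u_ℂ`
  have hF1 : lam hc z ∈ periodF (k3FormRat.restrict (k3FormRat.orthogonal N)) (omega x hdisj) 1 := by
    rw [mem_periodF_one, restrict_baseChange_apply, iota_omega hN hdisj, k3Form_comm]; exact hQx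
  have hF1c : lam hc z ∈ complexConj (periodF (k3FormRat.restrict (k3FormRat.orthogonal N)) (omega x hdisj) 1) := by
    rw [mem_complexConj_periodF_one, restrict_baseChange_apply, iota_conj_omega hN hdisj, k3Form_comm]; exact hQx'
  have hu1 : u.baseChange ℂ (lam hc z) ∈ periodF (k3FormRat.restrict (k3FormRat.orthogonal N)) (omega x hdisj) 1 :=
    hu 1 ⟨_, hF1, rfl⟩
  have hu1c : u.baseChange ℂ (lam hc z) ∈
      complexConj (periodF (k3FormRat.restrict (k3FormRat.orthogonal N)) (omega x hdisj) 1) := by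
    rw [mem_complexConj, conj_baseChange]
    exact hu 1 ⟨_, mem_complexConj.1 hF1c, rfl⟩
  rw [mem_periodF_one, restrict_baseChange_apply, iota_omega hN hdisj, iota_baseChange, k3Form_comm] at hu1
  rw [mem_complexConj_periodF_one, restrict_baseChange_apply, iota_conj_omega hN hdisj, iota_baseChange,
    k3Form_comm] at hu1c
  rw [← hz, map_add, h1, hQ]
  exact ⟨by rw [k3Form_add_left, hPx, zero_add]; exact hu1, by rw [k3Form_add_left, hPx', zero_add]; exact hu1c⟩

end Hodge

end Summit.HodgeConjecture.HodgeConjecture.Theorems.AnchorExistenceCMFloor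

end
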